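import Mathlib.Analysis.SpecialFunctions.Gamma.Basic
import Mathlib.Analysis.SpecialFunctions.Gamma.Beta
import Mathlib.Analysis.SpecialFunctions.Sqrt
import Mathlib.MeasureTheory.Integral.Bochner.Set
import Mathlib.MeasureTheory.Integral.IntervalIntegral.Basic
import Literature.Analysis.FunctionSpaces.BesselJ
import Literature.Probability.RandomPlanarGeometry.RectangleModulus
import Literature.Probability.RandomPlanarGeometry.EllipticKBasic
import HarnessLib

/-!
# Densities of short uniform planar random walks: Kluyver's Bessel integral and the
Borwein–Straub–Wan–Zudilin evaluation of `p₄(1)`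

Topic `Literature/Analysis/FunctionSpaces` (Bessel functions live here, cf. `BesselJ.lean`,
`BesselMoments.lean`). Named facts (statements only, D-0014) vendored for route
`HardSphereVirial` of summit `KontsevichZagierPeriods`: they ground the constant
`ρ = p₄(1) = √5·Γ(1/15)Γ(2/15)Γ(4/15)Γ(8/15)/(40π⁴)` appearing in
`Summit.KontsevichZagierPeriods.KontsevichZagierPeriods.Theses.HardSphereVirial.RingFiveDiscValue`
(the 5-ring Mayer diagram of hard discs, `V(C₅) = π⁴ − (67/72)π⁴ρ − (1315/128)/ρ`, an 87-digit
PSLQ identity of the planner) and the CM-period reading used by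
`Summit.KontsevichZagierPeriods.KontsevichZagierPeriods.Theses.HardSphereVirial.RingFiveDiscBeyondPattern`
(given that identity, non-membership of `V(C₅)` in `ℚπ⁴ + ℚ√3π³ + ℚπ² + ℚ√3π + ℚ` reduces to
the algebraic independence of `π` and the period `K₁₅` of a CM elliptic curve — Chudnovsky,
tree fact `Literature.NumberTheory.Transcendental.chudnovsky`, proved in tree).

## Source and printed statements (Borwein–Straub–Wan–Zudilin, *Densities of short uniform random
walks*, Canad. J. Math. 64 (2012) 961–990; arXiv:1103.2995, whose numbering we quote)

* §1: "An `n`-step uniform random walk is a walk in the plane that starts at the origin and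
  consists of `n` steps of length `1` each taken into a uniformly random direction. … we study the
  (radial) densities `p_n` of the distance travelled in `n` steps."
* §2, eq. (2.1): "It is a classical result of Kluyver [Klu06] that `p_n` has the following Bessel
  integral representation: `p_n(x) = ∫₀^∞ x t J₀(x t) J₀ⁿ(t) dt`."
* §5: "A surprising bonus is an evaluation of `r_{5,0} = p₄(1) ≈ 0.3299338011`, the residue [of
  `W₅`] at `s = −2`." **Theorem 9.**
  `r_{5,0} = (1/(2π²)) √( Γ(1/15)Γ(2/15)Γ(4/15)Γ(8/15) / (5 Γ(7/15)Γ(11/15)Γ(13/15)Γ(14/15)) )`.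
  "Proof. The value `τ = (√(−5/3) − 1)/2` in (4.15) gives the value `p₄(1) = r_{5,0}`. Applying the
  Chowla–Selberg formula [sc67, borwein-piagm] to evaluate the eta functions yields the claimed
  evaluation." Then: "Using [bz92], (5.1) may be simplified to
  `r_{5,0} = (√5/40) Γ(1/15)Γ(2/15)Γ(4/15)Γ(8/15)/π⁴ = (3√5/π³)·((√5 − 1)/2)·K₁₅² = (√15/π³) K_{5/3} K₁₅`,
  where `K₁₅` and `K_{5/3}` are the complete elliptic integral at the 15th and 5/3rd singular
  values [borwein-piagm]." (eqs. (5.2)–(5.3)).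

## What is vendored and how it is typed

* `pearsonDensityFourAtOne := ∫_{(0,∞)} t·J₀(t)⁵ dt` — the right-hand side of Kluyver's (2.1) at
  `n = 4`, `x = 1`. Since `|J₀(t)| ≤ 1` and `J₀(t) = O(t^{-1/2})` (`BesselJ.lean`:
  `abs_besselJ_zero_le_one`, `besselJ_isBigO_rpow_neg_half`) the integrand is `O(t^{-3/2})`, so the
  Lebesgue (Bochner) integral over `Ioi 0` converges absolutely and equals the printed improper
  integral; and `p₄` is continuous at `1` (BSWZ Thm 1 with `n = 0`), so this number IS the
  density value `p₄(1)` of the paper. We do not formalise "radial density of the walk"; a user who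
  needs that identification takes Kluyver's theorem separately.
* `BorweinStraubWanZudilin2012_thm9` — Theorem 9 verbatim (Gamma quotient under a square root),
  the ONE named fact for the closed form of `p₄(1)`; the simplified Gamma form (5.2),
  `p₄(1) = (√5/40)·G/π⁴`, is PROVED equivalent to it here (reflection formula at fifteenths,
  `BorweinStraubWanZudilin2012_thm9_iff_eq_5_2`) and is therefore carried as the theorem
  `BorweinStraubWanZudilin2012_eq_5_2_of_thm9 : thm9 → p₄(1) = (√5/40)·G/π⁴` — the printed
  direction "(5.1) may be simplified to (5.2)" — and not as a second named fact (review-split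
  2026-08-15: the former `BorweinStraubWanZudilin2012_eq_5_2 : Prop` was merged into Theorem 9,
  of which it was a proved restatement);
  `BorweinStraubWanZudilin2012_eq_5_3` — the step (5.2) → (5.3), i.e. the SECOND equality sign
  of that display: the identity of real numbers `(√5/40)·G/π⁴ = (3√5/π³)·((√5 − 1)/2)·K₁₅²`
  (`G = Γ(1/15)Γ(2/15)Γ(4/15)Γ(8/15)`), equivalently the Borwein–Zucker [bz92] singular-value
  evaluation `K₁₅² = (1 + √5)·G/(240π)` by which the source passes from (5.2) to (5.3) (cut this
  way by review-split 2026-08-15 so that the fact does not re-contain Theorem 9; the printed chain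
  read in full, `p₄(1) = (3√5/π³)((√5 − 1)/2)K₁₅²`, is the PROVED consequence
  `BorweinStraubWanZudilin2012_p4_one_eq_K15_of_eq_5_2` of (5.2) and (5.3), and given (5.2) the two
  readings are equivalent, `BorweinStraubWanZudilin2012_eq_5_3_iff_p4_one_eq_K15_of_eq_5_2`), with
  the 15th singular value typed by its defining property `K′(k₁₅)/K(k₁₅) = √15` (Borwein–Borwein,
  *Pi and the AGM*, the reference [borwein-piagm] of the source; exactly one such modulus exists,
  `Literature.Probability.RandomPlanarGeometry.existsUnique_singularModulus`, so the `∃ k` typing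
  is determinate: `BorweinStraubWanZudilin2012_eq_5_3_iff_forall`) and `K` the complete elliptic
  integral of the first kind ALREADY in the tree,
  `Literature.Probability.RandomPlanarGeometry.ellipticK u = ∫₀¹ dt/√((1−t²)(1−u t²))`
  (`RectangleModulus.lean`, PARAMETER convention `u = k²`, so the source's `K(k)` is
  `ellipticK (k ^ 2)` and `K′(k) = K(√(1 − k²))` is `ellipticK (1 − k ^ 2)`); no second `K` is
  introduced.
* Neither of the two named facts is proved here (what IS proved: Thm 9 ⇔ (5.2), and the algebra
  relating the two readings of (5.3), below); `(5.5)`–`(5.6)` of the source (the residue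
  `r_{5,1}`) are printed with `≟` (conjectural in the source) and are NOT vendored.

## References

* [BorweinEtAl2012] J. M. Borwein, A. Straub, J. Wan, W. Zudilin (appendix by D. Zagier),
  Densities of short uniform random walks, Canad. J. Math. 64 (2012), §2 eq. (2.1), §5 Thm 9,
  eqs. (5.2)–(5.3) (arXiv:1103.2995 numbering).
* [bz92] J. M. Borwein, I. J. Zucker, Fast evaluation of the gamma function for small rational
  fractions using complete elliptic integrals of the first kind, IMA J. Numer. Anal. 12 (1992)
  519–526 (the source's reference for the step (5.2) → (5.3); the `K₁₅` entry).
* J. M. Borwein, P. B. Borwein, *Pi and the AGM*, Wiley (1987), Ch. 4–5 (singular moduli `k_N`,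
  `K′(k_N)/K(k_N) = √N`; the source's [borwein-piagm]).
-/

noncomputable section

open _root_.MeasureTheory _root_.Set _root_.Real

namespace Literature.Analysis.FunctionSpaces

/-- **Kluyver's integral for `p₄(1)`**: the number `∫₀^∞ t J₀(t)⁵ dt`, i.e. the right-hand side of
Kluyver's Bessel representation `p_n(x) = ∫₀^∞ x t J₀(xt) J₀(t)ⁿ dt` of the radial density of the
`n`-step uniform planar random walk at `n = 4`, `x = 1` (absolutely convergent: the integrand is
`O(t^{-3/2})`; the junk-free Bochner integral over `(0, ∞)`). Numerically `0.3299338011…`.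
[cite: BorweinEtAl2012, §2 eq. (2.1) and §5] -/
def pearsonDensityFourAtOne : ℝ :=
  ∫ t in Ioi (0 : ℝ), t * besselJ 0 t ^ 5

/-- **Borwein–Straub–Wan–Zudilin 2012, Theorem 9** (statement only): with `r_{5,0} = p₄(1)` the
value at `1` of the 4-step density (`= ∫₀^∞ t J₀(t)⁵ dt` by Kluyver's formula (2.1)),
`p₄(1) = (1/(2π²)) · √( Γ(1/15)Γ(2/15)Γ(4/15)Γ(8/15) / (5·Γ(7/15)Γ(11/15)Γ(13/15)Γ(14/15)) )`
(proof in the source: modular parametrisation (4.15) of `p₄` at `τ = (√(−5/3) − 1)/2` and the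
Chowla–Selberg formula). Grounds the constant `ρ = p₄(1)` of
`Summit.KontsevichZagierPeriods.KontsevichZagierPeriods.Theses.HardSphereVirial.RingFiveDiscValue`.
[cite: BorweinEtAl2012, §5 Thm 9] -/
def BorweinStraubWanZudilin2012_thm9 : Prop :=
  pearsonDensityFourAtOne =
    1 / (2 * π ^ 2) *
      Real.sqrt (Real.Gamma (1 / 15) * Real.Gamma (2 / 15) * Real.Gamma (4 / 15) *
          Real.Gamma (8 / 15) /
        (5 * (Real.Gamma (7 / 15) * Real.Gamma (11 / 15) * Real.Gamma (13 / 15) *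
          Real.Gamma (14 / 15))))

/-- **Borwein–Straub–Wan–Zudilin 2012, eq. (5.3)** (statement only; the CM-period form of the
closed form (5.2)). After Theorem 9 the source prints: "Using [bz92], (5.1) may be simplified to
`r_{5,0} = (√5/40) Γ(1/15)Γ(2/15)Γ(4/15)Γ(8/15)/π⁴` (5.2)
`= (3√5/π³)·((√5 − 1)/2)·K₁₅² = (√15/π³) K_{5/3} K₁₅` (5.3), where `K₁₅` and `K_{5/3}` are the
complete elliptic integral at the 15th and 5/3rd singular values [borwein-piagm]." This named fact
is the SECOND equality sign of that display — the identity of real numbers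
`(√5/40)·G/π⁴ = (3√5/π³)·((√5 − 1)/2)·K₁₅²`, `G = Γ(1/15)Γ(2/15)Γ(4/15)Γ(8/15)` — i.e.
(equivalently, `BorweinStraubWanZudilin2012_eq_5_3_iff_ellipticK_sq`, pure algebra) the
Borwein–Zucker [bz92] / Borwein–Borwein singular-value evaluation `K₁₅² = (1 + √5)·G/(240π)`
(Chowla–Selberg for discriminant `−15`) by which the source passes from (5.2) to (5.3); no random
walk is involved in it. The FIRST equality sign, `p₄(1) = (√5/40)G/π⁴` (eq. (5.2)), is
Theorem 9 of the source in simplified form — the sibling fact `BorweinStraubWanZudilin2012_thm9`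
(⇔ (5.2): `BorweinStraubWanZudilin2012_thm9_iff_eq_5_2`, `BorweinStraubWanZudilin2012_eq_5_2_of_thm9`,
proved) — and the printed chain read in full, `p₄(1) = (3√5/π³)((√5 − 1)/2)K₁₅²`, is the PROVED
consequence `BorweinStraubWanZudilin2012_p4_one_eq_K15_of_thm9` of the two facts; given (5.2) the
two readings of (5.3) are equivalent (`BorweinStraubWanZudilin2012_eq_5_3_iff_p4_one_eq_K15_of_eq_5_2`).
(Cut this way — review-split 2026-08-15 — so that this fact does not re-contain Theorem 9.)
`K₁₅ = K(k₁₅)` is typed with the 15th singular modulus introduced by its defining property, the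
`0 < k₁₅ < 1` with `K(√(1 − k₁₅²)) = √15 · K(k₁₅)` (Borwein–Borwein, *Pi and the AGM*:
`K′(k_N)/K(k_N) = √N`; exactly one such modulus exists —
`Literature.Probability.RandomPlanarGeometry.existsUnique_singularModulus`, `K′/K` being strictly
decreasing — so the `∃ k` typing is determinate, `BorweinStraubWanZudilin2012_eq_5_3_iff_forall`),
and with the tree's `Literature.Probability.RandomPlanarGeometry.ellipticK` (parameter convention:
`K(k) = ellipticK (k ^ 2)`, `K′(k) = ellipticK (1 − k ^ 2)`). `K₁₅` is a period of the CM elliptic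
curve `y² = (1 − x²)(1 − k₁₅²x²)` (algebraic modulus, CM by an order of `ℚ(√−15)`), which is what
makes `p₄(1)·π³` a CM period. Numerically `k₁₅ ≈ 0.0091190063`, `K₁₅ ≈ 1.5708289837`, and both
sides `≈ 0.3299338011`. [cite: BorweinEtAl2012, §5 eq. (5.3)] -/
def BorweinStraubWanZudilin2012_eq_5_3 : Prop :=
  ∃ k : ℝ, 0 < k ∧ k < 1 ∧
    Literature.Probability.RandomPlanarGeometry.ellipticK (1 - k ^ 2) =
      Real.sqrt 15 * Literature.Probability.RandomPlanarGeometry.ellipticK (k ^ 2) ∧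
    Real.sqrt 5 / 40 *
        (Real.Gamma (1 / 15) * Real.Gamma (2 / 15) * Real.Gamma (4 / 15) * Real.Gamma (8 / 15)) /
          π ^ 4 =
      3 * Real.sqrt 5 / π ^ 3 * ((Real.sqrt 5 - 1) / 2) *
        Literature.Probability.RandomPlanarGeometry.ellipticK (k ^ 2) ^ 2


/-! ## The "[bz92] simplification" `Thm 9 ⇒ (5.2)`, proved

The source derives (5.2) from Theorem 9 in one sentence: "Using [bz92], (5.1) may be simplified
to (5.2)". That step is elementary and is proved here in full: by the reflection formula
`Γ(s)Γ(1−s) = π / sin(πs)` applied to the pairs `(1,14), (2,13), (4,11), (8,7)` (fifteenths),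
`G·H = π⁴ / (sin(π/15) sin(2π/15) sin(4π/15) sin(8π/15)) = 16 π⁴`, where
`G = Γ(1/15)Γ(2/15)Γ(4/15)Γ(8/15)`, `H = Γ(7/15)Γ(11/15)Γ(13/15)Γ(14/15)`, the sine product
being `1/16` (product-to-sum and `cos(π/5) = (1+√5)/4`). Hence
`(1/(2π²))√(G/(5H)) = (1/(2π²))·G/(4√5π²) = (√5/40)·G/π⁴`, i.e. the right-hand sides of
Theorem 9 and of eq. (5.2) are the same real number, and Theorem 9 is equivalent to (5.2)
(`BorweinStraubWanZudilin2012_thm9_iff_eq_5_2`, with (5.2) written out). What remains unproved is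
Theorem 9 itself (the modular parametrisation (4.15) of `p₄` at `τ = (√(−5/3) − 1)/2` plus
Chowla–Selberg), i.e. the fact `BorweinStraubWanZudilin2012_thm9`; eq. (5.2) then follows by
`BorweinStraubWanZudilin2012_eq_5_2_of_thm9`. Because of this proved equivalence, (5.2) is NOT a
separate named fact (review-split 2026-08-15: a former `BorweinStraubWanZudilin2012_eq_5_2 : Prop`,
a proved restatement of Theorem 9, was merged into it; one unproved theorem, one named fact).
[cite: BorweinEtAl2012, §5, sentence after Thm 9]
-/

/-- Product-to-sum: `sin x · sin y = (cos(x − y) − cos(x + y))/2`. [folklore] -/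
private theorem sin_mul_sin_eq_half_cos_sub (x y : ℝ) :
    Real.sin x * Real.sin y = (Real.cos (x - y) - Real.cos (x + y)) / 2 := by
  rw [Real.cos_sub, Real.cos_add]
  ring

/-- The sine product over the `2`-orbit of fifteenths:
`sin(π/15) · sin(2π/15) · sin(4π/15) · sin(8π/15) = 1/16`.
Proof: `sin(π/15)sin(4π/15) = (cos(π/5) − cos(π/3))/2`, `sin(2π/15)sin(8π/15) =
(cos(2π/5) − cos(2π/3))/2`, `cos(π/5) = (1 + √5)/4`, `cos(2π/5) = 2cos²(π/5) − 1`. [folklore] -/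
theorem prod_sin_pi_div_fifteen :
    Real.sin (π / 15) * Real.sin (2 * π / 15) * Real.sin (4 * π / 15) * Real.sin (8 * π / 15) =
      1 / 16 := by
  have h1 : Real.sin (π / 15) * Real.sin (4 * π / 15) = (Real.cos (π / 5) - 1 / 2) / 2 := by
    rw [sin_mul_sin_eq_half_cos_sub]
    have e1 : π / 15 - 4 * π / 15 = -(π / 5) := by ring
    have e2 : π / 15 + 4 * π / 15 = π / 3 := by ring
    rw [e1, e2, Real.cos_neg, Real.cos_pi_div_three]
  have h2 : Real.sin (2 * π / 15) * Real.sin (8 * π / 15) =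
      (Real.cos (2 * (π / 5)) + 1 / 2) / 2 := by
    rw [sin_mul_sin_eq_half_cos_sub]
    have e1 : 2 * π / 15 - 8 * π / 15 = -(2 * (π / 5)) := by ring
    have e2 : 2 * π / 15 + 8 * π / 15 = π - π / 3 := by ring
    rw [e1, e2, Real.cos_neg, Real.cos_pi_sub, Real.cos_pi_div_three]
    ring
  have h5 : Real.sqrt 5 ^ 2 = 5 := Real.sq_sqrt (by norm_num)
  calc Real.sin (π / 15) * Real.sin (2 * π / 15) * Real.sin (4 * π / 15) * Real.sin (8 * π / 15)
      = (Real.sin (π / 15) * Real.sin (4 * π / 15)) *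
          (Real.sin (2 * π / 15) * Real.sin (8 * π / 15)) := by ring
    _ = 1 / 16 := by
      rw [h1, h2, Real.cos_two_mul, Real.cos_pi_div_five]
      linear_combination (Real.sqrt 5 + 1) / 128 * h5

/-- Reflection at fifteenths: with `G = Γ(1/15)Γ(2/15)Γ(4/15)Γ(8/15)` and
`H = Γ(7/15)Γ(11/15)Γ(13/15)Γ(14/15)`, `G · H = 16 π⁴` (pair `k/15` with `1 − k/15` in
`Γ(s)Γ(1−s) = π/sin(πs)` and use `prod_sin_pi_div_fifteen`). This is the content of the
"[bz92]" simplification of the source. [cite: BorweinEtAl2012, §5, after Thm 9] -/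
theorem prod_Gamma_fifteenths :
    Real.Gamma (1 / 15) * Real.Gamma (2 / 15) * Real.Gamma (4 / 15) * Real.Gamma (8 / 15) *
        (Real.Gamma (7 / 15) * Real.Gamma (11 / 15) * Real.Gamma (13 / 15) *
          Real.Gamma (14 / 15)) =
      16 * π ^ 4 := by
  have r1 : Real.Gamma (1 / 15) * Real.Gamma (14 / 15) = π / Real.sin (π / 15) := by
    have h := Real.Gamma_mul_Gamma_one_sub (1 / 15 : ℝ)
    rwa [show (1 : ℝ) - 1 / 15 = 14 / 15 by norm_num,
      show π * (1 / 15 : ℝ) = π / 15 by ring] at h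
  have r2 : Real.Gamma (2 / 15) * Real.Gamma (13 / 15) = π / Real.sin (2 * π / 15) := by
    have h := Real.Gamma_mul_Gamma_one_sub (2 / 15 : ℝ)
    rwa [show (1 : ℝ) - 2 / 15 = 13 / 15 by norm_num,
      show π * (2 / 15 : ℝ) = 2 * π / 15 by ring] at h
  have r4 : Real.Gamma (4 / 15) * Real.Gamma (11 / 15) = π / Real.sin (4 * π / 15) := by
    have h := Real.Gamma_mul_Gamma_one_sub (4 / 15 : ℝ)
    rwa [show (1 : ℝ) - 4 / 15 = 11 / 15 by norm_num,
      show π * (4 / 15 : ℝ) = 4 * π / 15 by ring] at h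
  have r8 : Real.Gamma (8 / 15) * Real.Gamma (7 / 15) = π / Real.sin (8 * π / 15) := by
    have h := Real.Gamma_mul_Gamma_one_sub (8 / 15 : ℝ)
    rwa [show (1 : ℝ) - 8 / 15 = 7 / 15 by norm_num,
      show π * (8 / 15 : ℝ) = 8 * π / 15 by ring] at h
  calc Real.Gamma (1 / 15) * Real.Gamma (2 / 15) * Real.Gamma (4 / 15) * Real.Gamma (8 / 15) *
        (Real.Gamma (7 / 15) * Real.Gamma (11 / 15) * Real.Gamma (13 / 15) *
          Real.Gamma (14 / 15))
      = (Real.Gamma (1 / 15) * Real.Gamma (14 / 15)) *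
          (Real.Gamma (2 / 15) * Real.Gamma (13 / 15)) *
          (Real.Gamma (4 / 15) * Real.Gamma (11 / 15)) *
          (Real.Gamma (8 / 15) * Real.Gamma (7 / 15)) := by ring
    _ = π ^ 4 / (Real.sin (π / 15) * Real.sin (2 * π / 15) * Real.sin (4 * π / 15) *
          Real.sin (8 * π / 15)) := by
        rw [r1, r2, r4, r8]
        ring
    _ = 16 * π ^ 4 := by
        rw [prod_sin_pi_div_fifteen]
        ring

/-- The right-hand sides of Theorem 9 and of eq. (5.2) of the source are the same real number:
`(1/(2π²)) √(G/(5H)) = (√5/40) G/π⁴` (from `G·H = 16π⁴`, `G, H > 0`).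
[cite: BorweinEtAl2012, §5 Thm 9 and eq. (5.2)] -/
theorem BorweinStraubWanZudilin2012_thm9_rhs_eq_eq_5_2_rhs :
    1 / (2 * π ^ 2) *
        Real.sqrt (Real.Gamma (1 / 15) * Real.Gamma (2 / 15) * Real.Gamma (4 / 15) *
            Real.Gamma (8 / 15) /
          (5 * (Real.Gamma (7 / 15) * Real.Gamma (11 / 15) * Real.Gamma (13 / 15) *
            Real.Gamma (14 / 15)))) =
      Real.sqrt 5 / 40 *
        (Real.Gamma (1 / 15) * Real.Gamma (2 / 15) * Real.Gamma (4 / 15) * Real.Gamma (8 / 15)) /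
          π ^ 4 := by
  set G : ℝ := Real.Gamma (1 / 15) * Real.Gamma (2 / 15) * Real.Gamma (4 / 15) *
    Real.Gamma (8 / 15)
  set H : ℝ := Real.Gamma (7 / 15) * Real.Gamma (11 / 15) * Real.Gamma (13 / 15) *
    Real.Gamma (14 / 15)
  have hG : 0 < G :=
    mul_pos (mul_pos (mul_pos (Real.Gamma_pos_of_pos (by norm_num))
      (Real.Gamma_pos_of_pos (by norm_num))) (Real.Gamma_pos_of_pos (by norm_num)))
      (Real.Gamma_pos_of_pos (by norm_num))
  have hH : 0 < H :=
    mul_pos (mul_pos (mul_pos (Real.Gamma_pos_of_pos (by norm_num))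
      (Real.Gamma_pos_of_pos (by norm_num))) (Real.Gamma_pos_of_pos (by norm_num)))
      (Real.Gamma_pos_of_pos (by norm_num))
  have hGH : G * H = 16 * π ^ 4 := prod_Gamma_fifteenths
  have h5 : Real.sqrt 5 ^ 2 = 5 := Real.sq_sqrt (by norm_num)
  have hden : 0 < 4 * Real.sqrt 5 * π ^ 2 := by positivity
  have key : G / (5 * H) = (G / (4 * Real.sqrt 5 * π ^ 2)) ^ 2 := by
    rw [div_pow, div_eq_div_iff (mul_pos (by norm_num) hH).ne' (pow_pos hden 2).ne']
    have hsq : (4 * Real.sqrt 5 * π ^ 2) ^ 2 = 80 * π ^ 4 := by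
      rw [mul_pow, mul_pow, h5]; ring
    rw [hsq]
    linear_combination (-(5 * G)) * hGH
  rw [key, Real.sqrt_sq (div_pos hG hden).le]
  have h40 : Real.sqrt 5 / 40 = 1 / (8 * Real.sqrt 5) := by
    rw [div_eq_div_iff (by norm_num) (by positivity)]
    linear_combination 8 * h5
  rw [h40]
  ring

/-- **Theorem 9 ⇔ eq. (5.2)** of Borwein–Straub–Wan–Zudilin 2012: the two printed closed forms
for `p₄(1)` agree, so Theorem 9 holds iff `p₄(1) = (√5/40)·Γ(1/15)Γ(2/15)Γ(4/15)Γ(8/15)/π⁴`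
(the source's "[bz92] simplification", proved; eq. (5.2) written out explicitly).
[cite: BorweinEtAl2012, §5 Thm 9, eq. (5.2)] -/
theorem BorweinStraubWanZudilin2012_thm9_iff_eq_5_2 :
    BorweinStraubWanZudilin2012_thm9 ↔
      pearsonDensityFourAtOne =
        Real.sqrt 5 / 40 *
          (Real.Gamma (1 / 15) * Real.Gamma (2 / 15) * Real.Gamma (4 / 15) * Real.Gamma (8 / 15)) /
            π ^ 4 := by
  unfold BorweinStraubWanZudilin2012_thm9
  rw [BorweinStraubWanZudilin2012_thm9_rhs_eq_eq_5_2_rhs]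

/-- **Borwein–Straub–Wan–Zudilin 2012, eq. (5.2)**, from Theorem 9 — the direction printed in the
source ("Using [bz92], (5.1) may be simplified to (5.2)"):
`p₄(1) = (√5/40) · Γ(1/15)Γ(2/15)Γ(4/15)Γ(8/15) / π⁴` (`≈ 0.3299338011`). This is the form used
by route `HardSphereVirial` (`ρ = √5·G/(40π⁴)`, `G = Γ(1/15)Γ(2/15)Γ(4/15)Γ(8/15)`): a user who
wants `ρ` in this form assumes the named fact `BorweinStraubWanZudilin2012_thm9` and applies this
theorem; once Theorem 9 is discharged, (5.2) holds outright. (5.2) is deliberately NOT a separate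
named fact: it is a proved restatement of Theorem 9 (`BorweinStraubWanZudilin2012_thm9_iff_eq_5_2`).
[cite: BorweinEtAl2012, §5 eq. (5.2)] -/
theorem BorweinStraubWanZudilin2012_eq_5_2_of_thm9 (h : BorweinStraubWanZudilin2012_thm9) :
    pearsonDensityFourAtOne =
      Real.sqrt 5 / 40 *
        (Real.Gamma (1 / 15) * Real.Gamma (2 / 15) * Real.Gamma (4 / 15) * Real.Gamma (8 / 15)) /
          π ^ 4 :=
  BorweinStraubWanZudilin2012_thm9_iff_eq_5_2.1 h

/-- Conversely Theorem 9 from eq. (5.2) (written out). [cite: BorweinEtAl2012, §5 Thm 9] -/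
theorem BorweinStraubWanZudilin2012_thm9_of_eq_5_2
    (h : pearsonDensityFourAtOne =
      Real.sqrt 5 / 40 *
        (Real.Gamma (1 / 15) * Real.Gamma (2 / 15) * Real.Gamma (4 / 15) * Real.Gamma (8 / 15)) /
          π ^ 4) :
    BorweinStraubWanZudilin2012_thm9 :=
  BorweinStraubWanZudilin2012_thm9_iff_eq_5_2.2 h

/-! ## The two readings of (5.3), related (proved)

`BorweinStraubWanZudilin2012_eq_5_3` is the second equality sign of the display (5.2)–(5.3)
(`(√5/40)G/π⁴ = (3√5/π³)((√5−1)/2)K₁₅²`). Below: (i) it is equivalent, by pure algebra, to the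
Borwein–Zucker value `K₁₅² = (1+√5)G/(240π)`; (ii) its `∃ k` typing is determinate; (iii) together
with (5.2) (written out; equivalently with Theorem 9) it yields the printed chain read in full,
`p₄(1) = (3√5/π³)((√5−1)/2)K₁₅²`, and given (5.2) the two readings of (5.3) are equivalent.
Nothing is assumed beyond the displayed hypotheses. [cite: BorweinEtAl2012, §5 eqs. (5.2)–(5.3)]
-/

/-- The algebra of the step (5.2) → (5.3): for any real `K`,
`(√5/40)·G/π⁴ = (3√5/π³)·((√5 − 1)/2)·K²  ⟺  K² = (1 + √5)·G/(240π)`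
(`G = Γ(1/15)Γ(2/15)Γ(4/15)Γ(8/15) > 0`). [cite: BorweinEtAl2012, §5 eqs. (5.2)–(5.3)] -/
theorem BorweinStraubWanZudilin2012_eq_5_2_rhs_eq_K15_form_iff (K : ℝ) :
    Real.sqrt 5 / 40 *
          (Real.Gamma (1 / 15) * Real.Gamma (2 / 15) * Real.Gamma (4 / 15) * Real.Gamma (8 / 15)) /
            π ^ 4 =
        3 * Real.sqrt 5 / π ^ 3 * ((Real.sqrt 5 - 1) / 2) * K ^ 2 ↔
      K ^ 2 =
        (1 + Real.sqrt 5) *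
            (Real.Gamma (1 / 15) * Real.Gamma (2 / 15) * Real.Gamma (4 / 15) *
              Real.Gamma (8 / 15)) /
          (240 * π) := by
  set G := Real.Gamma (1 / 15) * Real.Gamma (2 / 15) * Real.Gamma (4 / 15) * Real.Gamma (8 / 15)
    with hG
  have h5 : Real.sqrt 5 ^ 2 = 5 := Real.sq_sqrt (by norm_num)
  have h5pos : 0 < Real.sqrt 5 := Real.sqrt_pos.mpr (by norm_num)
  have h51 : 0 < Real.sqrt 5 - 1 := by
    have : (1:ℝ) < Real.sqrt 5 := by
      rw [show (1:ℝ) = Real.sqrt 1 by simp]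
      exact Real.sqrt_lt_sqrt (by norm_num) (by norm_num)
    linarith
  have hpi := Real.pi_pos
  constructor
  · intro hK
    rw [eq_div_iff (by positivity)]
    rw [div_eq_iff (by positivity)] at hK
    have hK'' : G = 60 * (Real.sqrt 5 - 1) * K ^ 2 * π := by
      have hne : Real.sqrt 5 / 40 ≠ 0 := by positivity
      have hπ : π ≠ 0 := Real.pi_pos.ne'
      apply mul_left_cancel₀ hne
      rw [hK]
      field_simp
      ring
    rw [hK'']
    linear_combination (-(60:ℝ) * K ^ 2 * π) * h5
  · intro hK
    rw [eq_div_iff (by positivity)] at hK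
    rw [div_eq_iff (by positivity)]
    have hG' : G = 60 * (Real.sqrt 5 - 1) * K ^ 2 * π := by
      have h4 : (1 + Real.sqrt 5) * (Real.sqrt 5 - 1) = 4 := by linear_combination h5
      have hne : (1 + Real.sqrt 5) ≠ 0 := by positivity
      apply mul_left_cancel₀ hne
      linear_combination (-(1:ℝ)) * hK + (-(60:ℝ) * K ^ 2 * π) * h4
    rw [hG']
    field_simp
    ring

/-- **(5.3) is the Borwein–Zucker value of `K₁₅`**: the named fact
`BorweinStraubWanZudilin2012_eq_5_3` holds iff some modulus `0 < k < 1` with `K′(k) = √15 K(k)`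
has `K(k)² = (1 + √5) Γ(1/15)Γ(2/15)Γ(4/15)Γ(8/15) / (240 π)` ("Using [bz92]" in the source).
[cite: BorweinEtAl2012, §5 eqs. (5.2)–(5.3)] -/
theorem BorweinStraubWanZudilin2012_eq_5_3_iff_ellipticK_sq :
    BorweinStraubWanZudilin2012_eq_5_3 ↔
      ∃ k : ℝ, 0 < k ∧ k < 1 ∧
        Literature.Probability.RandomPlanarGeometry.ellipticK (1 - k ^ 2) =
          Real.sqrt 15 * Literature.Probability.RandomPlanarGeometry.ellipticK (k ^ 2) ∧
        Literature.Probability.RandomPlanarGeometry.ellipticK (k ^ 2) ^ 2 =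
          (1 + Real.sqrt 5) *
            (Real.Gamma (1 / 15) * Real.Gamma (2 / 15) * Real.Gamma (4 / 15) *
              Real.Gamma (8 / 15)) /
            (240 * π) := by
  unfold BorweinStraubWanZudilin2012_eq_5_3
  refine exists_congr fun k => ?_
  refine and_congr_right fun _ => and_congr_right fun _ => and_congr_right fun _ => ?_
  exact BorweinStraubWanZudilin2012_eq_5_2_rhs_eq_K15_form_iff _

/-- **(5.3) is determinate**: because the 15th singular modulus exists and is unique
(`existsUnique_singularModulus`), the `∃ k`-typed fact `BorweinStraubWanZudilin2012_eq_5_3` is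
equivalent to its `∀ k` reading — for every modulus `0 < k < 1` with `K′(k) = √15 K(k)`,
`(√5/40)G/π⁴ = (3√5/π³)((√5−1)/2) K(k)²`. [cite: BorweinEtAl2012, §5 eq. (5.3)] -/
theorem BorweinStraubWanZudilin2012_eq_5_3_iff_forall :
    BorweinStraubWanZudilin2012_eq_5_3 ↔
      ∀ k : ℝ, 0 < k → k < 1 →
        Literature.Probability.RandomPlanarGeometry.ellipticK (1 - k ^ 2) =
          Real.sqrt 15 * Literature.Probability.RandomPlanarGeometry.ellipticK (k ^ 2) →
        Real.sqrt 5 / 40 *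
            (Real.Gamma (1 / 15) * Real.Gamma (2 / 15) * Real.Gamma (4 / 15) *
              Real.Gamma (8 / 15)) / π ^ 4 =
          3 * Real.sqrt 5 / π ^ 3 * ((Real.sqrt 5 - 1) / 2) *
            Literature.Probability.RandomPlanarGeometry.ellipticK (k ^ 2) ^ 2 := by
  obtain ⟨k₀, ⟨hk₀0, hk₀1, hk₀⟩, huniq⟩ :=
    Literature.Probability.RandomPlanarGeometry.existsUnique_singularModulus
      (show (0 : ℝ) < 15 by norm_num)
  unfold BorweinStraubWanZudilin2012_eq_5_3
  constructor
  · rintro ⟨k, hk0, hk1, hk, hP⟩ k' hk0' hk1' hk'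
    have e1 : k = k₀ := huniq k ⟨hk0, hk1, hk⟩
    have e2 : k' = k₀ := huniq k' ⟨hk0', hk1', hk'⟩
    rw [e2, ← e1]
    exact hP
  · intro h
    exact ⟨k₀, hk₀0, hk₀1, hk₀, h k₀ hk₀0 hk₀1 hk₀⟩

/-- **Given (5.2), the two readings of (5.3) coincide**: assuming eq. (5.2),
`p₄(1) = (√5/40)G/π⁴` (written out; from Theorem 9 by
`BorweinStraubWanZudilin2012_eq_5_2_of_thm9`), the fact `BorweinStraubWanZudilin2012_eq_5_3`
(second equality sign of the display) is equivalent to the printed chain read in full,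
`p₄(1) = (3√5/π³)((√5−1)/2)K₁₅²` at the 15th singular modulus.
[cite: BorweinEtAl2012, §5 eqs. (5.2)–(5.3)] -/
theorem BorweinStraubWanZudilin2012_eq_5_3_iff_p4_one_eq_K15_of_eq_5_2
    (h2 : pearsonDensityFourAtOne =
      Real.sqrt 5 / 40 *
        (Real.Gamma (1 / 15) * Real.Gamma (2 / 15) * Real.Gamma (4 / 15) * Real.Gamma (8 / 15)) /
          π ^ 4) :
    BorweinStraubWanZudilin2012_eq_5_3 ↔
      ∃ k : ℝ, 0 < k ∧ k < 1 ∧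
        Literature.Probability.RandomPlanarGeometry.ellipticK (1 - k ^ 2) =
          Real.sqrt 15 * Literature.Probability.RandomPlanarGeometry.ellipticK (k ^ 2) ∧
        pearsonDensityFourAtOne =
          3 * Real.sqrt 5 / π ^ 3 * ((Real.sqrt 5 - 1) / 2) *
            Literature.Probability.RandomPlanarGeometry.ellipticK (k ^ 2) ^ 2 := by
  unfold BorweinStraubWanZudilin2012_eq_5_3
  rw [h2]

/-- **The printed chain (5.2)–(5.3) read in full**: from eq. (5.2) (written out) and the named
fact (5.3), `p₄(1) = (3√5/π³)·((√5 − 1)/2)·K₁₅²` with `K₁₅ = K(k₁₅)` at the 15th singular modulus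
(`0 < k₁₅ < 1`, `K′(k₁₅) = √15 K(k₁₅)`). This is the original (pre-review-split) typing of the fact
`BorweinStraubWanZudilin2012_eq_5_3`, now a consequence. [cite: BorweinEtAl2012, §5 eq. (5.3)] -/
theorem BorweinStraubWanZudilin2012_p4_one_eq_K15_of_eq_5_2
    (h2 : pearsonDensityFourAtOne =
      Real.sqrt 5 / 40 *
        (Real.Gamma (1 / 15) * Real.Gamma (2 / 15) * Real.Gamma (4 / 15) * Real.Gamma (8 / 15)) /
          π ^ 4)
    (h3 : BorweinStraubWanZudilin2012_eq_5_3) :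
    ∃ k : ℝ, 0 < k ∧ k < 1 ∧
      Literature.Probability.RandomPlanarGeometry.ellipticK (1 - k ^ 2) =
        Real.sqrt 15 * Literature.Probability.RandomPlanarGeometry.ellipticK (k ^ 2) ∧
      pearsonDensityFourAtOne =
        3 * Real.sqrt 5 / π ^ 3 * ((Real.sqrt 5 - 1) / 2) *
          Literature.Probability.RandomPlanarGeometry.ellipticK (k ^ 2) ^ 2 :=
  (BorweinStraubWanZudilin2012_eq_5_3_iff_p4_one_eq_K15_of_eq_5_2 h2).1 h3

/-- The same from Theorem 9 in place of (5.2) (`BorweinStraubWanZudilin2012_thm9_iff_eq_5_2`).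
[cite: BorweinEtAl2012, §5 Thm 9, eq. (5.3)] -/
theorem BorweinStraubWanZudilin2012_p4_one_eq_K15_of_thm9
    (h9 : BorweinStraubWanZudilin2012_thm9) (h3 : BorweinStraubWanZudilin2012_eq_5_3) :
    ∃ k : ℝ, 0 < k ∧ k < 1 ∧
      Literature.Probability.RandomPlanarGeometry.ellipticK (1 - k ^ 2) =
        Real.sqrt 15 * Literature.Probability.RandomPlanarGeometry.ellipticK (k ^ 2) ∧
      pearsonDensityFourAtOne =
        3 * Real.sqrt 5 / π ^ 3 * ((Real.sqrt 5 - 1) / 2) *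
          Literature.Probability.RandomPlanarGeometry.ellipticK (k ^ 2) ^ 2 :=
  BorweinStraubWanZudilin2012_p4_one_eq_K15_of_eq_5_2
    (BorweinStraubWanZudilin2012_thm9_iff_eq_5_2.1 h9) h3

end Literature.Analysis.FunctionSpaces

end
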